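import Literature.AnabelianGeometry.SemiGraphs.TemperoidsHomEqResProofs
import HarnessLib

/-!
# [SemiAnbd] Thm A.4, chart route (Galois-countable case), step S1c: the comparison maps
# `θ_X : X → φ^*(X)` on the relative category `T₂[A₂] ⊆ B^temp(Π₂)` and `B^temp(f)|_{T₂[A₂]} ≅ φ^*`

Mochizuki, *Semi-graphs of anabelioids*, Publ. RIMS **42** (2006) 221–322, Appendix, Thm A.4
(author's manuscript pp. 82–86) [cite: MochizukiSemiAnbd2006, Thm A.4 pp.82-86], existence
half along the cell's CHART ROUTE (abc-iut L3-lead rulings μ3-1/ν3-1, 2026-08-26): after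
`thmA4_iff_exists` (`QuasiTemperoidsThmA4Unique.lean`) one needs, for a functor
`F : T₂[A₂] ⥤ B^temp(Π₁)` preserving finite limits and countable colimits, a continuous
`f : Π₁ → Π₂` with `B^temp(f)|_{T₂[A₂]} ≅ F`.  This proof-only file PORTS to the relative setting
the last step of the tree's proof of [SemiAnbd] Prop. 3.2 (`TemperoidsHomEqResProofs.lean`):
GIVEN `f`, a cofinal antitone sequence `N_k` of open normal subgroups with `Π₂/N_k ∈ T₂[A₂]`,
compatible base points `y_k ∈ F(Π₂/N_k)` with `a · y_k = F(r_{f a}) y_k` (step S1b) and the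
torsor structure of the fibres `F(Π₂/N_k)` (step S1a), the comparison maps
`θ_X(x) := F(o_x)(y_k)` (`o_x : Π₂/N_k → X` the orbit map, a morphism of `T₂[A₂]`) are level
independent, natural, `f`-equivariant, bijective on connected objects, hence — by the orbit
decomposition `BTemp.exists_cofan_orbits`, which stays inside `T₂[A₂]` and is preserved by
`F` — bijective everywhere, and assemble to `T₂[A₂].ι ⋙ B^temp(f) ≅ F`
(`exists_natIso_res_of_torsorData`).

Stated for an ARBITRARY object property `P` of `B^temp(Π₂)` closed under sources of morphisms
and containing the `Π₂/N_k`; the chart `T₂[A₂] = Over' A₂` (resp. `BTempRel Π₂ H₂`) is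
`P = admitsHomTo A₂` (resp. `admitsHomToCoset Π₂ H₂`), where `hP f ⟨g⟩ = ⟨f ≫ g⟩`.  The torsor
facts are HYPOTHESES here (discharged in steps S1a/S1b); no named fact, no definition.  Honest
scope (ν3-1): the chart route needs a cofinal SEQUENCE `N_k` (Galois-countability) and does not
by itself close the named fact `ThmA4`.  Nothing here bears on anything disputed.
-/
namespace Literature.AnabelianGeometry.SemiGraphs

namespace BTemp

open CategoryTheory CategoryTheory.Limits Topology Filter
open Literature.AlgebraicGeometry.Frobenioids (IsConnectedObj)

universe u

section Bookkeeping

variable {G : Type u} [Group G] [TopologicalSpace G]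

/-- Morphisms of `B^temp(Π)` are determined by their underlying maps. [folklore] -/
private theorem hom_ext₅ {X Y : BTemp G} (f g : X ⟶ Y) (h : ∀ x, f.hom.hom x = g.hom.hom x) :
    f = g := by
  apply ObjectProperty.hom_ext
  apply Action.Hom.ext
  exact ConcreteCategory.hom_ext _ _ h

/-- The action of a `Π`-set is multiplicative on elements. [folklore] -/
private theorem ρ_mul_apply₅ (X : BTemp G) (g h : G) (x : X.obj.V) :
    X.obj.ρ (g * h) x = X.obj.ρ g (X.obj.ρ h x) := by
  rw [map_mul]
  rfl

/-- Composition in `B^temp(Π)` on elements. [folklore] -/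
private theorem comp_hom_hom_apply₅ {X Y Z : BTemp G} (f : X ⟶ Y) (g : Y ⟶ Z) (x : X.obj.V) :
    (f ≫ g).hom.hom x = g.hom.hom (f.hom.hom x) := rfl

end Bookkeeping

/-! ### The comparison maps on the relative category -/

section Rel

variable {G₁ : Type u} [Group G₁] [TopologicalSpace G₁]
  {G₂ : Type u} [Group G₂] [TopologicalSpace G₂] [IsTopologicalGroup G₂] (hG₂ : IsTempered G₂)
  (P : ObjectProperty (BTemp G₂)) (F : P.FullSubcategory ⥤ BTemp G₁)
  (N : ℕ → OpenNormalSubgroup G₂) (hNP : ∀ k, P (Q hG₂ (N k)))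
  (y : ∀ k, (F.obj ⟨Q hG₂ (N k), hNP k⟩).obj.V)

/-- **Level independence** (relative form).  With compatible base points, `F(o_x)(y_k)` does not
depend on the level `k` at which the orbit map of `x` — a morphism `Π₂/N_k → X` of `T₂[A₂]` — is
taken. [cite: MochizukiSemiAnbd2006, Thm A.4 pp.82-86] -/
theorem theta_level_eq_rel (hNanti : Antitone N)
    (hycompat : ∀ j k, j ≤ k → ∀ h : N k ≤ N j,
      (F.map (ObjectProperty.homMk (proj hG₂ h))).hom.hom (y k) = y j)
    (X : P.FullSubcategory) (x : X.obj.obj.V) (j k : ℕ) (hj : (N j).toSubgroup ≤ stab X.obj x)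
    (hk : (N k).toSubgroup ≤ stab X.obj x) :
    (F.map (ObjectProperty.homMk (orbitMap hG₂ X.obj x (N j) hj))).hom.hom (y j) =
      (F.map (ObjectProperty.homMk (orbitMap hG₂ X.obj x (N k) hk))).hom.hom (y k) := by
  wlog hjk : j ≤ k generalizing j k
  · exact (this k j hk hj (le_of_not_ge hjk)).symm
  have hcomp : (ObjectProperty.homMk (proj hG₂ (hNanti hjk)) :
        (⟨Q hG₂ (N k), hNP k⟩ : P.FullSubcategory) ⟶ ⟨Q hG₂ (N j), hNP j⟩) ≫
      (ObjectProperty.homMk (orbitMap hG₂ X.obj x (N j) hj) :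
        (⟨Q hG₂ (N j), hNP j⟩ : P.FullSubcategory) ⟶ X) =
      ObjectProperty.homMk (orbitMap hG₂ X.obj x (N k) hk) := by
    apply ObjectProperty.hom_ext
    exact proj_orbitMap hG₂ (hNanti hjk) X.obj x hj hk
  rw [← hycompat j k hjk (hNanti hjk), ← hcomp, F.map_comp]
  rfl

/-- **Naturality** (relative form).  `F(f)(F(o_x) y_k) = F(o_{f x}) y_k` for a morphism `f : X → X'`
of `T₂[A₂]`. [cite: MochizukiSemiAnbd2006, Thm A.4 pp.82-86] -/
theorem theta_natural_rel (k : ℕ) {X X' : P.FullSubcategory} (f : X ⟶ X') (x : X.obj.obj.V)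
    (hk : (N k).toSubgroup ≤ stab X.obj x) (hk' : (N k).toSubgroup ≤ stab X'.obj (f.hom.hom.hom x)) :
    (F.map f).hom.hom
        ((F.map (ObjectProperty.homMk (orbitMap hG₂ X.obj x (N k) hk))).hom.hom (y k)) =
      (F.map (ObjectProperty.homMk (orbitMap hG₂ X'.obj (f.hom.hom.hom x) (N k) hk'))).hom.hom (y k) := by
  have hcomp : (ObjectProperty.homMk (orbitMap hG₂ X.obj x (N k) hk) :
        (⟨Q hG₂ (N k), hNP k⟩ : P.FullSubcategory) ⟶ X) ≫ f =
      ObjectProperty.homMk (orbitMap hG₂ X'.obj (f.hom.hom.hom x) (N k) hk') := by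
    apply ObjectProperty.hom_ext
    exact orbitMap_comp_hom hG₂ (N k) f.hom x hk hk'
  rw [← hcomp, F.map_comp]
  rfl

/-- **Equivariance** (relative form).  If `a · y_k = F(r_{f a}) y_k`, then
`a · F(o_x) y_k = F(o_{f(a) x}) y_k`. [cite: MochizukiSemiAnbd2006, Thm A.4 pp.82-86] -/
theorem theta_equivariant_rel (φ : G₁ →ₜ* G₂) (k : ℕ)
    (hφ : ∀ a : G₁, (F.obj ⟨Q hG₂ (N k), hNP k⟩).obj.ρ a (y k) =
      (F.map (ObjectProperty.homMk (rightMul hG₂ (N k) (φ a)))).hom.hom (y k))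
    (X : P.FullSubcategory) (x : X.obj.obj.V) (hk : (N k).toSubgroup ≤ stab X.obj x) (a : G₁)
    (hk' : (N k).toSubgroup ≤ stab X.obj (X.obj.obj.ρ (φ a) x)) :
    (F.obj X).obj.ρ a
        ((F.map (ObjectProperty.homMk (orbitMap hG₂ X.obj x (N k) hk))).hom.hom (y k)) =
      (F.map (ObjectProperty.homMk (orbitMap hG₂ X.obj (X.obj.obj.ρ (φ a) x) (N k) hk'))).hom.hom (y k) := by
  have hcomp : (ObjectProperty.homMk (rightMul hG₂ (N k) (φ a)) :
        (⟨Q hG₂ (N k), hNP k⟩ : P.FullSubcategory) ⟶ ⟨Q hG₂ (N k), hNP k⟩) ≫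
      (ObjectProperty.homMk (orbitMap hG₂ X.obj x (N k) hk) :
        (⟨Q hG₂ (N k), hNP k⟩ : P.FullSubcategory) ⟶ X) =
      ObjectProperty.homMk (orbitMap hG₂ X.obj (X.obj.obj.ρ (φ a) x) (N k) hk') := by
    apply ObjectProperty.hom_ext
    exact rightMul_orbitMap hG₂ (N k) X.obj x hk (φ a) hk'
  rw [← hom_hom_ρ, hφ a, ← hcomp, F.map_comp]
  rfl

/-- **Bijectivity on connected objects** (relative form).  For a transitive nonempty `X` of
`T₂[A₂]` (base point `x₀` fixed by `N_k`), `g x₀ ↦ F(o_{g x₀}) y_k` is a bijection `X → F(X)` —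
GIVEN the torsor structure of the fibre `F(Π₂/N_k)` (the right action of `Π₂/N_k` through the
`F(r_g)` is transitive and free) and the description of `F(o_{x₀})` as the quotient by the stabiliser
(surjective, fibres = stabiliser orbits); these three inputs are the relative ports of
`fibreQ_transitive`, `fibreQ_coe_eq_of_rightMul_eq`, `map_orbitMap` (step S1a).
[cite: MochizukiSemiAnbd2006, Thm A.4 pp.82-86] -/
theorem theta_bijective_of_transitive_rel (k : ℕ) (X : P.FullSubcategory) (x₀ : X.obj.obj.V)
    (htr : ∀ x : X.obj.obj.V, ∃ g : G₂, X.obj.obj.ρ g x₀ = x)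
    (hk₀ : (N k).toSubgroup ≤ stab X.obj x₀)
    (hsurj : ∀ z : (F.obj X).obj.V, ∃ y' : (F.obj ⟨Q hG₂ (N k), hNP k⟩).obj.V,
      (F.map (ObjectProperty.homMk (orbitMap hG₂ X.obj x₀ (N k) hk₀))).hom.hom y' = z)
    (hfib : ∀ y₁ y₂ : (F.obj ⟨Q hG₂ (N k), hNP k⟩).obj.V,
      (F.map (ObjectProperty.homMk (orbitMap hG₂ X.obj x₀ (N k) hk₀))).hom.hom y₁ =
        (F.map (ObjectProperty.homMk (orbitMap hG₂ X.obj x₀ (N k) hk₀))).hom.hom y₂ →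
      ∃ h ∈ stab X.obj x₀,
        (F.map (ObjectProperty.homMk (rightMul hG₂ (N k) h))).hom.hom y₁ = y₂)
    (htransY : ∀ y₁ y₂ : (F.obj ⟨Q hG₂ (N k), hNP k⟩).obj.V, ∃ g : G₂,
      (F.map (ObjectProperty.homMk (rightMul hG₂ (N k) g))).hom.hom y₁ = y₂)
    (hfree : ∀ (g g' : G₂) (y₁ : (F.obj ⟨Q hG₂ (N k), hNP k⟩).obj.V),
      (F.map (ObjectProperty.homMk (rightMul hG₂ (N k) g) :
          (⟨Q hG₂ (N k), hNP k⟩ : P.FullSubcategory) ⟶ ⟨Q hG₂ (N k), hNP k⟩)).hom.hom y₁ =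
        (F.map (ObjectProperty.homMk (rightMul hG₂ (N k) g'))).hom.hom y₁ →
      (g : G₂ ⧸ (N k).toSubgroup) = g') :
    (∀ z : (F.obj X).obj.V, ∃ x : X.obj.obj.V, ∃ hx : (N k).toSubgroup ≤ stab X.obj x,
        (F.map (ObjectProperty.homMk (orbitMap hG₂ X.obj x (N k) hx))).hom.hom (y k) = z) ∧
    ∀ (x x' : X.obj.obj.V) (hx : (N k).toSubgroup ≤ stab X.obj x)
      (hx' : (N k).toSubgroup ≤ stab X.obj x'),
      (F.map (ObjectProperty.homMk (orbitMap hG₂ X.obj x (N k) hx))).hom.hom (y k) =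
        (F.map (ObjectProperty.homMk (orbitMap hG₂ X.obj x' (N k) hx'))).hom.hom (y k) → x = x' := by
  -- `F(o_{g x₀}) y_k = F(o_{x₀}) (F(r_g) y_k)`
  have key : ∀ (g : G₂) (hx : (N k).toSubgroup ≤ stab X.obj (X.obj.obj.ρ g x₀)),
      (F.map (ObjectProperty.homMk (orbitMap hG₂ X.obj (X.obj.obj.ρ g x₀) (N k) hx))).hom.hom (y k) =
        (F.map (ObjectProperty.homMk (orbitMap hG₂ X.obj x₀ (N k) hk₀))).hom.hom
          ((F.map (ObjectProperty.homMk (rightMul hG₂ (N k) g) :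
            (⟨Q hG₂ (N k), hNP k⟩ : P.FullSubcategory) ⟶ ⟨Q hG₂ (N k), hNP k⟩)).hom.hom (y k)) := by
    intro g hx
    have hcomp : (ObjectProperty.homMk (rightMul hG₂ (N k) g) :
          (⟨Q hG₂ (N k), hNP k⟩ : P.FullSubcategory) ⟶ ⟨Q hG₂ (N k), hNP k⟩) ≫
        (ObjectProperty.homMk (orbitMap hG₂ X.obj x₀ (N k) hk₀) :
          (⟨Q hG₂ (N k), hNP k⟩ : P.FullSubcategory) ⟶ X) =
        ObjectProperty.homMk (orbitMap hG₂ X.obj (X.obj.obj.ρ g x₀) (N k) hx) := by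
      apply ObjectProperty.hom_ext
      exact rightMul_orbitMap hG₂ (N k) X.obj x₀ hk₀ g hx
    rw [← hcomp, F.map_comp]
    rfl
  refine ⟨fun z => ?_, fun x x' hx hx' hxx => ?_⟩
  · obtain ⟨y', hy'⟩ := hsurj z
    obtain ⟨g, hg⟩ := htransY (y k) y'
    refine ⟨X.obj.obj.ρ g x₀, le_stab_ρ (N k) X.obj x₀ hk₀ g, ?_⟩
    rw [key, hg, hy']
  · obtain ⟨g, rfl⟩ := htr x
    obtain ⟨g', rfl⟩ := htr x'
    rw [key, key] at hxx
    obtain ⟨h, hh, hhy⟩ := hfib _ _ hxx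
    have h1 : (F.map (ObjectProperty.homMk (rightMul hG₂ (N k) (g * h)) :
          (⟨Q hG₂ (N k), hNP k⟩ : P.FullSubcategory) ⟶ ⟨Q hG₂ (N k), hNP k⟩)).hom.hom (y k) =
        (F.map (ObjectProperty.homMk (rightMul hG₂ (N k) g') :
          (⟨Q hG₂ (N k), hNP k⟩ : P.FullSubcategory) ⟶ ⟨Q hG₂ (N k), hNP k⟩)).hom.hom (y k) := by
      have hcomp : (ObjectProperty.homMk (rightMul hG₂ (N k) g) :
            (⟨Q hG₂ (N k), hNP k⟩ : P.FullSubcategory) ⟶ ⟨Q hG₂ (N k), hNP k⟩) ≫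
          (ObjectProperty.homMk (rightMul hG₂ (N k) h) :
            (⟨Q hG₂ (N k), hNP k⟩ : P.FullSubcategory) ⟶ ⟨Q hG₂ (N k), hNP k⟩) =
          ObjectProperty.homMk (rightMul hG₂ (N k) (g * h)) := by
        apply ObjectProperty.hom_ext
        exact rightMul_comp hG₂ (N k) g h
      rw [← hhy, ← hcomp, F.map_comp]
      rfl
    have h2 := hfree _ _ _ h1
    -- `g' = g h n` with `n ∈ N_k ⊆ Stab(x₀)` and `h ∈ Stab(x₀)`
    rw [QuotientGroup.eq] at h2
    have h3 : X.obj.obj.ρ ((g * h)⁻¹ * g') x₀ = x₀ := hk₀ h2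
    have h4 : X.obj.obj.ρ h x₀ = x₀ := hh
    calc X.obj.obj.ρ g x₀ = X.obj.obj.ρ g (X.obj.obj.ρ h (X.obj.obj.ρ ((g * h)⁻¹ * g') x₀)) := by
          rw [h3, h4]
      _ = X.obj.obj.ρ (g * h * ((g * h)⁻¹ * g')) x₀ := by
          rw [ρ_mul_apply₅ X.obj (g * h) ((g * h)⁻¹ * g') x₀, ρ_mul_apply₅ X.obj g h]
      _ = X.obj.obj.ρ g' x₀ := by rw [mul_inv_cancel_left]

end Rel

/-! ### Assembly: the natural isomorphism `T₂[A₂].ι ⋙ B^temp(f) ≅ F` -/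

section Assembly

variable {G₁ : Type u} [Group G₁] [TopologicalSpace G₁] [IsTopologicalGroup G₁]
  {G₂ : Type u} [Group G₂] [TopologicalSpace G₂] [IsTopologicalGroup G₂] (hG₂ : IsTempered G₂)
  (P : ObjectProperty (BTemp G₂)) (F : P.FullSubcategory ⥤ BTemp G₁)

/-- **The relative comparison isomorphism** ([SemiAnbd] Thm. A.4, existence half, chart route —
the port of the last step of Prop. 3.2 to `T₂[A₂]`).  Let `P` be an object property of `B^temp(Π₂)`
closed under sources of morphisms, `F : P.FullSubcategory ⥤ B^temp(Π₁)` a functor preserving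
countable coproducts, `f : Π₁ → Π₂` a continuous homomorphism, `N_k` an antitone sequence of open
normal subgroups of `Π₂` cofinal in the neighbourhoods of `1` with `Π₂/N_k ∈ P`, and
`y_k ∈ F(Π₂/N_k)` base points compatible under the projections with `a · y_k = F(r_{f a}) y_k`.
Assume the torsor facts (step S1a): for every `k`, `Π₂` acts transitively and `Π₂/N_k` freely on
`F(Π₂/N_k)` through the `F(r_g)`, and for every transitive `X ∈ P` with base point `x₀` fixed by
`N_k`, `F(o_{x₀})` is surjective with fibres the stabiliser orbits.  Then the comparison maps
`θ_X(x) = F(o_x)(y_k)` assemble to a natural isomorphism `P.ι ⋙ B^temp(f) ≅ F`.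
[cite: MochizukiSemiAnbd2006, Thm A.4 pp.82-86] -/
theorem exists_natIso_res_of_torsorData
    (hP : ∀ {X Y : BTemp G₂}, (X ⟶ Y) → P Y → P X)
    (hcoprod : ∀ (ι : Type) [Countable ι], PreservesColimitsOfShape (Discrete ι) F)
    (φ : G₁ →ₜ* G₂) (N : ℕ → OpenNormalSubgroup G₂) (hNP : ∀ k, P (Q hG₂ (N k)))
    (y : ∀ k, (F.obj ⟨Q hG₂ (N k), hNP k⟩).obj.V) (hNanti : Antitone N)
    (hNbasis : ∀ U ∈ 𝓝 (1 : G₂), ∃ k, (N k : Set G₂) ⊆ U)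
    (hycompat : ∀ j k, j ≤ k → ∀ h : N k ≤ N j,
      (F.map (ObjectProperty.homMk (proj hG₂ h))).hom.hom (y k) = y j)
    (hφ : ∀ (k : ℕ) (a : G₁), (F.obj ⟨Q hG₂ (N k), hNP k⟩).obj.ρ a (y k) =
      (F.map (ObjectProperty.homMk (rightMul hG₂ (N k) (φ a)))).hom.hom (y k))
    (htransY : ∀ (k : ℕ) (y₁ y₂ : (F.obj ⟨Q hG₂ (N k), hNP k⟩).obj.V), ∃ g : G₂,
      (F.map (ObjectProperty.homMk (rightMul hG₂ (N k) g))).hom.hom y₁ = y₂)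
    (hfree : ∀ (k : ℕ) (g g' : G₂) (y₁ : (F.obj ⟨Q hG₂ (N k), hNP k⟩).obj.V),
      (F.map (ObjectProperty.homMk (rightMul hG₂ (N k) g) :
          (⟨Q hG₂ (N k), hNP k⟩ : P.FullSubcategory) ⟶ ⟨Q hG₂ (N k), hNP k⟩)).hom.hom y₁ =
        (F.map (ObjectProperty.homMk (rightMul hG₂ (N k) g'))).hom.hom y₁ →
      (g : G₂ ⧸ (N k).toSubgroup) = g')
    (hmo : ∀ (k : ℕ) (X : P.FullSubcategory) (x₀ : X.obj.obj.V),
      (∀ x : X.obj.obj.V, ∃ g : G₂, X.obj.obj.ρ g x₀ = x) →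
      ∀ hk₀ : (N k).toSubgroup ≤ stab X.obj x₀,
      (∀ z : (F.obj X).obj.V, ∃ y' : (F.obj ⟨Q hG₂ (N k), hNP k⟩).obj.V,
        (F.map (ObjectProperty.homMk (orbitMap hG₂ X.obj x₀ (N k) hk₀))).hom.hom y' = z) ∧
      ∀ y₁ y₂ : (F.obj ⟨Q hG₂ (N k), hNP k⟩).obj.V,
        (F.map (ObjectProperty.homMk (orbitMap hG₂ X.obj x₀ (N k) hk₀))).hom.hom y₁ =
          (F.map (ObjectProperty.homMk (orbitMap hG₂ X.obj x₀ (N k) hk₀))).hom.hom y₂ →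
        ∃ h ∈ stab X.obj x₀,
          (F.map (ObjectProperty.homMk (rightMul hG₂ (N k) h))).hom.hom y₁ = y₂) :
    Nonempty (P.ι ⋙ BTemp.res φ ≅ F) := by
  classical
  -- every point is fixed by some `N_k`
  have hlev : ∀ (X : P.FullSubcategory) (x : X.obj.obj.V), ∃ k, (N k).toSubgroup ≤ stab X.obj x := by
    intro X x
    have h1 : (stab X.obj x : Set G₂) ∈ 𝓝 (1 : G₂) :=
      (X.obj.property.2 x).mem_nhds (stab X.obj x).one_mem
    obtain ⟨k, hk⟩ := hNbasis _ h1
    exact ⟨k, fun g hg => hk hg⟩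
  let kOf : ∀ X : P.FullSubcategory, X.obj.obj.V → ℕ := fun X x => Classical.choose (hlev X x)
  have hkOf : ∀ (X : P.FullSubcategory) (x : X.obj.obj.V),
      (N (kOf X x)).toSubgroup ≤ stab X.obj x := fun X x => Classical.choose_spec (hlev X x)
  -- the comparison maps
  let θ : ∀ X : P.FullSubcategory, X.obj.obj.V → (F.obj X).obj.V := fun X x =>
    (F.map (ObjectProperty.homMk (orbitMap hG₂ X.obj x (N (kOf X x)) (hkOf X x)) :
      (⟨Q hG₂ (N (kOf X x)), hNP (kOf X x)⟩ : P.FullSubcategory) ⟶ X)).hom.hom (y (kOf X x))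
  have hθ : ∀ (X : P.FullSubcategory) (x : X.obj.obj.V) (k : ℕ)
      (hk : (N k).toSubgroup ≤ stab X.obj x),
      θ X x = (F.map (ObjectProperty.homMk (orbitMap hG₂ X.obj x (N k) hk) :
        (⟨Q hG₂ (N k), hNP k⟩ : P.FullSubcategory) ⟶ X)).hom.hom (y k) :=
    fun X x k hk => theta_level_eq_rel hG₂ P F N hNP y hNanti hycompat X x _ _ _ _
  have hnat : ∀ {X X' : P.FullSubcategory} (f : X ⟶ X') (x : X.obj.obj.V),
      (F.map f).hom.hom (θ X x) = θ X' (f.hom.hom.hom x) := by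
    intro X X' f x
    rw [hθ X' (f.hom.hom.hom x) (kOf X x) ((hkOf X x).trans (stab_le_stab_hom f.hom x))]
    exact theta_natural_rel hG₂ P F N hNP y (kOf X x) f x (hkOf X x) _
  have hequiv : ∀ (X : P.FullSubcategory) (a : G₁) (x : X.obj.obj.V),
      θ X (X.obj.obj.ρ (φ a) x) = (F.obj X).obj.ρ a (θ X x) := by
    intro X a x
    rw [hθ X (X.obj.obj.ρ (φ a) x) (kOf X x) (le_stab_ρ (N (kOf X x)) X.obj x (hkOf X x) (φ a))]
    exact (theta_equivariant_rel hG₂ P F N hNP y φ (kOf X x) (hφ (kOf X x)) X x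
      (hkOf X x) a _).symm
  -- bijective on connected objects
  have hbij_conn : ∀ X : P.FullSubcategory, IsConnectedObj X.obj → Function.Bijective (θ X) := by
    intro X hX
    obtain ⟨⟨x₀⟩, htr⟩ := (BTemp.isConnectedObj_iff X.obj).mp hX
    have hall : ∀ x : X.obj.obj.V, (N (kOf X x₀)).toSubgroup ≤ stab X.obj x := fun x => by
      obtain ⟨g, rfl⟩ := htr x₀ x
      exact le_stab_ρ _ X.obj x₀ (hkOf X x₀) g
    obtain ⟨hs, hi⟩ := theta_bijective_of_transitive_rel hG₂ P F N hNP y (kOf X x₀) X x₀ (htr x₀)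
      (hkOf X x₀) (hmo (kOf X x₀) X x₀ (htr x₀) (hkOf X x₀)).1
      (hmo (kOf X x₀) X x₀ (htr x₀) (hkOf X x₀)).2 (htransY (kOf X x₀)) (hfree (kOf X x₀))
    constructor
    · intro x x' h
      rw [hθ X x _ (hall x), hθ X x' _ (hall x')] at h
      exact hi x x' (hall x) (hall x') h
    · intro z
      obtain ⟨x, hx, hxz⟩ := hs z
      exact ⟨x, by rw [hθ X x _ hx, hxz]⟩
  -- bijective on all objects: the orbit decomposition stays inside `P` and is preserved by `F`
  have hbij : ∀ A : P.FullSubcategory, Function.Bijective (θ A) := by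
    intro A
    obtain ⟨ι, _, X, hconn, c, ⟨hc⟩, ⟨e⟩⟩ := BTemp.exists_cofan_orbits A.obj
    have hc' : IsColimit (Cofan.mk c.pt c.inj) :=
      IsColimit.ofIsoColimit hc (Cocone.ext (Iso.refl _) (by
        rintro ⟨i⟩
        simp only [Cofan.mk_ι_app, Iso.refl_hom]
        rfl))
    -- the cofan as a cofan of `P.FullSubcategory`
    have hptP : P c.pt := hP e.hom A.property
    have hXP : ∀ i, P (X i) := fun i => hP (c.inj i ≫ e.hom) A.property
    let pt' : P.FullSubcategory := ⟨c.pt, hptP⟩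
    let X' : ι → P.FullSubcategory := fun i => ⟨X i, hXP i⟩
    let inj' : ∀ i, X' i ⟶ pt' := fun i => ObjectProperty.homMk (c.inj i)
    have hcP : IsColimit (Cofan.mk pt' inj') :=
      isColimitOfReflects P.ι ((isColimitMapCoconeCofanMkEquiv P.ι X' inj').symm hc')
    haveI : PreservesColimitsOfShape (Discrete ι) F := hcoprod ι
    have hFc : IsColimit (Cofan.mk (F.obj pt') fun i => F.map (inj' i)) :=
      isColimitCofanMkObjOfIsColimit F X' inj' hcP
    have hbij_pt : Function.Bijective (θ pt') := by
      constructor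
      · intro p p' h
        obtain ⟨i, v, rfl⟩ := BTemp.cofan_inj_jointly_surjective c.inj hc' p
        obtain ⟨j, v', rfl⟩ := BTemp.cofan_inj_jointly_surjective c.inj hc' p'
        have h' : (F.map (inj' i)).hom.hom (θ (X' i) v) = (F.map (inj' j)).hom.hom (θ (X' j) v') := by
          rw [hnat (inj' i) v, hnat (inj' j) v']
          exact h
        obtain rfl := BTemp.cofan_eq_of_inj_apply_eq (fun i => F.map (inj' i)) hFc _ _ h'
        have hv : v = v' := (hbij_conn (X' i) (hconn i)).1
          (BTemp.cofan_inj_injective (fun i => F.map (inj' i)) hFc i h')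
        rw [hv]
      · intro z
        obtain ⟨i, w, rfl⟩ :=
          BTemp.cofan_inj_jointly_surjective (fun i => F.map (inj' i)) hFc z
        obtain ⟨v, rfl⟩ := (hbij_conn (X' i) (hconn i)).2 w
        exact ⟨(c.inj i).hom.hom v, (hnat (inj' i) v).symm⟩
    -- transfer along the isomorphism `c.pt ≅ A` (an isomorphism of `P.FullSubcategory`)
    let e' : pt' ≅ A := P.isoMk e
    have hinv : ∀ x : A.obj.obj.V, e'.hom.hom.hom.hom (e'.inv.hom.hom.hom x) = x := fun x => by
      change (e'.inv ≫ e'.hom).hom.hom.hom x = x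
      rw [e'.inv_hom_id]
      rfl
    constructor
    · intro x x' h
      have h1 : θ pt' (e'.inv.hom.hom.hom x) = θ pt' (e'.inv.hom.hom.hom x') := by
        rw [← hnat e'.inv x, ← hnat e'.inv x']
        exact congrArg _ h
      have h2 := hbij_pt.1 h1
      rw [← hinv x, ← hinv x', h2]
    · intro z
      obtain ⟨p, hp⟩ := hbij_pt.2 ((F.map e'.inv).hom.hom z)
      refine ⟨e'.hom.hom.hom.hom p, ?_⟩
      rw [← hnat e'.hom p, hp, ← comp_hom_hom_apply₅, ← F.map_comp, e'.inv_hom_id, F.map_id]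
      rfl
  -- the natural isomorphism `P.ι ⋙ B^temp(φ) ≅ F`
  let E : ∀ X : P.FullSubcategory, X.obj.obj.V ≃ (F.obj X).obj.V := fun X =>
    Equiv.ofBijective (θ X) (hbij X)
  have hE : ∀ (X : P.FullSubcategory) (x : X.obj.obj.V), E X x = θ X x := fun X x => rfl
  let η : ∀ X : P.FullSubcategory, (P.ι ⋙ BTemp.res φ).obj X ≅ F.obj X := fun X =>
    { hom := homOfEquivariant ((BTemp.res φ).obj X.obj) (F.obj X) (θ X)
        (fun a x => hequiv X a x)
      inv := homOfEquivariant (F.obj X) ((BTemp.res φ).obj X.obj) (E X).symm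
        (fun a z => by
          apply (hbij X).1
          change θ X ((E X).symm _) = θ X (X.obj.obj.ρ (φ a) ((E X).symm z))
          rw [hequiv, ← hE, ← hE, Equiv.apply_symm_apply, Equiv.apply_symm_apply])
      hom_inv_id := by
        apply hom_ext₅
        intro x
        change (E X).symm (θ X x) = x
        rw [← hE, Equiv.symm_apply_apply]
      inv_hom_id := by
        apply hom_ext₅
        intro z
        change θ X ((E X).symm z) = z
        rw [← hE, Equiv.apply_symm_apply] }
  refine ⟨NatIso.ofComponents η (fun {X Y} f => ?_)⟩
  apply hom_ext₅
  intro x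
  change θ Y (f.hom.hom.hom x) = (F.map f).hom.hom (θ X x)
  rw [hnat]

end Assembly

end BTemp

end Literature.AnabelianGeometry.SemiGraphs
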